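/-
Copyright: cell `pub-ymgap` (HUMAN RULING D-0062), Track A of `YM-PLAN.md`, DAG node N20 (= NE7b); R134 acceleration seat
`pub-ymgap-dag-n20-c` (strategy s1, generation 22), module 62.  Released under the licence of the surrounding project.
-/
import Summits.QuantumFields.YangMills.Theorems.BalabanUVNodesN20LCSMinimiserEnergyComparison
import Summits.QuantumFields.YangMills.Theorems.BalabanUVNodesN20LCSPatternMonotone
import HarnessLib

/-!
# YM-DAG node N20 (= NE7b), row s1, module 62: THE ALL-LEVELS CLASS WEIGHT BOUND ON BAŁABAN's LABEL TOWER WITH NO DISPLAYED LETTER OF BAŁABAN's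
# KIND — dag-n20-d's by-value currency (module 36, modulo `hreg` only) ∘ this seat's energy comparison (module 59, `hreg` proved at every level);
# level-DEPENDENT rates (gainful at fixed depth)

Track A of `YM-PLAN.md` (cell `pub-ymgap`, HUMAN RULING D-0062), node **N20** = spine estimate NE7b (`T4WeightBudget.RelWeightBound`, NOT
PRINTED, NOT PROVED).  Seat `pub-ymgap-dag-n20-c` (R134, s1), generation 22, module 62.  Kernel theorems only: 0 `def`, 0 `sorry`, standard
axioms; COUNT-NEUTRAL.  Composition BY NAME of module 36 (`…N20LCSPatternMonotone.sum_admS_integral_le_rec_allLevels_byValue` — dag-n20-d g7's by-value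
multi-level bound at the residual of record: arbitrary finite set `J` of pinned levels, LEVEL-DEPENDENT rates `τ`, volumes `v`, the regularity letters `hreg`
its ONLY analytic hypothesis), module 59 (`…N20LCSMinimiserEnergyComparison.hreg_canon_of_crude` — `hreg` PROVED at every level at the canonical regions for
`B ≥ B_k = √(N·n⋆_k)·L^{2(k+1)}`) and module 51 (`…N20LCSCanonicalSkeleton`: skeleton `exists_canon_skeleton`, size `card_canon_le`).  Nothing is re-declared.

WHAT THIS FILE PROVES.  ★★★ `sum_admS_integral_le_rec_allLevels_crude`: there are level-dependent `τ k > 0`, `v k ≥ 0` (module 36's) such that for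
`g₀⁻² ≥ 4N`, every `E₀`, every finite set `J` of pinned levels `j < K` (geometric letters `j + 1 ≤ m + K`, `L^{j+1}M₁ ∣ 2L^{m+K}`, `LM₁ ≤ sideχ_j`, `0 < ε_{j+1}`),
and EVERY family of pinned cubes `D j`, there is a `39^d`-dense skeleton `D′ j ⊆ D j` such that for every cutoff `K′` and every label pattern `E` pinning
`D j` at `j ∈ J` and free elsewhere:
`Σ_{h ∈ admS … K′} ∫ eterm ρ₀ K′ h dμ_{K′} ≤ Π_{j ∈ J, j < K′} (m_j·e^{v_{j+1}}·e^{−τ_{j+1}·g₀⁻²·ε⋆_j²∕(2N)})^{#D′ j} · ∫ ρ₀ dU₀`,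
`m_j = d²(9LM₂R_{j+1})^d`, `ε⋆_j = ε_{j+1}∕B_j = ε_{j+1}·η_{j+1}²∕√(N·n⋆_j)`, `n⋆_j = d²(9·sideχ_j)^d` — **NO HYPOTHESIS OF [Balaban1985Variational]'s OR THE CLUSTER
EXPANSION's KIND AT ANY LEVEL**; what is displayed is numerics ∕ geometry.  (Module 36 §5 had the same with NO letter in the DEGENERATE regime `εreg ≤ ε₁`
only; this holds in Bałaban's regime `ε_{j+1} < εreg` too.)

WHAT THIS MEANS FOR N20 (located, honest).  This is the (α)-road's class weight bound on the OBJECT OF RECORD for arbitrary pinned families at arbitrary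
finitely many levels, kernel-closed with no analytic letter — the first such display in the lineage.  It is NOT NE7b: the rates are LEVEL-DEPENDENT twice over
(dag-n20-d's `τ_{j+1} ~ L^{−4j}` by value, this seat's `B_j ~ L^{4j}` by energy comparison), so the per-cube factor is `< 1` only at FIXED DEPTH from the UV end
for small couplings (`p₀ > 2r`; module 61's `γ(θ)` at level `0`); the level-UNIFORM bound = «LCS-j» by name ((W♮), THE wall, (A1c)) + [Balaban1985Variational]
Thm 1 (8) (level-uniform `B`, K0's pen).  NE7b NOT PRINTED ∕ NOT PROVED; (α)-instance 0∕1; N20 NOT discharged; typed 28∕28, count untouched; one finite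
four-torus at fixed `ε` — NOT ℝ⁴, NOT infinite volume, NOT OS, NOT a mass gap, NOT Clay.

References (LOCATORS): T. Bałaban, CMP 119 (1988) 243–285 [Balaban1988Convergent] ((2.16)–(2.17) p.257, (3.2) p.265, (3.26)–(3.30) pp.270–271); CMP 122
(1989) 175–202 [Balaban1989LargeFieldI] ((0.3)–(0.5) pp.176–177); CMP 102 (1985) 277–309 [Balaban1985Variational] (Thm 1 (8)–(9) p.279).
-/

set_option autoImplicit false

noncomputable section

open scoped BigOperators

namespace Summit.QuantumFields.YangMills.BalabanUVNodes.N20LCSAllLevelsCrude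

open MeasureTheory
open Literature.MathematicalPhysics.QuantumFieldTheory.Balaban1983to89
open Literature.MathematicalPhysics.QuantumFieldTheory.Balaban1983to89.T4Continuum
open Literature.MathematicalPhysics.QuantumFieldTheory.Balaban1983to89.Node00
open B15DeterminingSets B14.Eq213DetSet B14.Eq213MaximalDomains B15Eq112TorusCover B14DomainGeom
open Summit.QuantumFields.BalabanUV.T4Continuum.B16HistoryIndexedRepr (GoodClass)
open Summit.QuantumFields.BalabanUV.T4Continuum.B16HistoryReprChain
open Summit.QuantumFields.BalabanUV.T4Continuum.NE7b.PrefixExtraction (admS)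
open Summit.QuantumFields.YangMills.BalabanUVNodes.N20LCSLabelTower
open Summit.QuantumFields.YangMills.BalabanUVNodes.N20LCSCanonicalSkeleton (exists_canon_skeleton card_canon_le)
open Summit.QuantumFields.YangMills.BalabanUVNodes.N20LCSMinimiserEnergyComparison (hreg_canon_of_crude)
open Summit.QuantumFields.YangMills.BalabanUVNodes.N20LCSPatternMonotone (sum_admS_integral_le_rec_allLevels_byValue)

variable (F : T4Family) (N : ℕ) [NeZero N] (ν : Stage7Numerics) (M : ℕ) (p : B12.RunParams) (g : ℕ → ℝ)

open Classical in
/-- ★★★ **THE ALL-LEVELS CLASS WEIGHT BOUND ON BAŁABAN's LABEL TOWER AT THE RESIDUAL OF RECORD, NO DISPLAYED LETTER OF BAŁABAN's KIND** (module 36's by-value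
bound with its regularity letters SUPPLIED by module 59 at the canonical regions, per-level thresholds `ε⋆_j = ε_{j+1}·η_{j+1}²∕√(N·n⋆_j)`, on a `39^d`-dense
skeleton of ANY pinned family): LEVEL-DEPENDENT rates (`τ`, `v` of dag-n20-d's by-value currency; `B_j = √(N·n⋆_j)·L^{2(j+1)}` of this seat's energy comparison)
— gainful at fixed depth only; the level-uniform statement is (W♮) + [Balaban1985Variational] Thm 1 (8), NOT claimed.
[cite: Balaban1988Convergent, (3.2) p.265, (3.26)–(3.30) pp.270–271, (2.16)–(2.17) p.257; Balaban1989LargeFieldI, (0.3)–(0.5) pp.176–177; Balaban1985Variational, Thm 1 (9) p.279] -/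
theorem sum_admS_integral_le_rec_allLevels_crude (A₁ : ℝ) (hM₂ : 0 < ν.M₂) (hM₁ : 1 ≤ ν.M₁) :
    ∃ τ : ℕ → ℝ, (∀ k, 0 < τ k) ∧ ∃ v : ℕ → ℝ, (∀ k, 0 ≤ v k) ∧ ∀ (g₀ E₀ : ℝ), 4 * N ≤ g₀⁻¹ ^ 2 →
      ∀ (J : Finset ℕ), (∀ j ∈ J, j < p.K) → (∀ j ∈ J, j + 1 ≤ (F.P p.K).m + (F.P p.K).K) →
      (∀ j ∈ J, side (F.P p.K).L ν.M₁ (j + 1) ∣ (F.P p.K).sitesPerDir 0) → (∀ j ∈ J, side (F.P p.K).L ν.M₁ 1 ≤ sideχ F ν p g j) →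
      (∀ j ∈ J, 0 < epsOfRecord ν g (j + 1)) →
      ∀ (D : (j : ℕ) → Finset (Iχ F ν p g j)), ∃ D' : (j : ℕ) → Finset (Iχ F ν p g j),
        (∀ j, D' j ⊆ D j ∧ (D j).card ≤ 39 ^ (F.P p.K).d * (D' j).card) ∧
      ∀ (K' : ℕ) (E : (j : ℕ) → (Fin j → LabelPat F ν p g) → Finset (LbOfRecord F ν p g j)),
        (∀ j ∈ J, ∀ h t, t ∈ E j h → D j ⊆ t.1) → (∀ j, j ∉ J → ∀ h, E j h = Finset.univ) →
        ∑ h ∈ admS (labelTowerOfRecord F N ν M p g A₁ (zeta316OfRecord F N ν M A₁)) (labelPattern F ν p g E) K',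
            ∫ x, (labelTowerOfRecord F N ν M p g A₁ (zeta316OfRecord F N ν M A₁)).eterm (rhoZeroOfRecord F N p.K g₀ E₀) K' h x
              ∂(lawOfRecord F N p.K K') ≤
          (∏ j ∈ J.filter (· < K'),
              ((((F.P p.K).d ^ 2 * (9 * ((F.P p.K).L * ν.M₂ * RkOfRecord (F.P p.K).L ν.r (g (j + 1)))) ^ (F.P p.K).d : ℕ) : ℝ) *
                (Real.exp (v (j + 1)) * Real.exp (-(τ (j + 1) * g₀⁻¹ ^ 2 *
                  ((epsOfRecord ν g (j + 1) /
                      (Real.sqrt ((N : ℝ) * (((F.P p.K).d ^ 2 * (9 * sideχ F ν p g j) ^ (F.P p.K).d : ℕ) : ℝ)) *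
                        ((F.P p.K).L : ℝ) ^ (2 * (j + 1)))) ^ 2 / (2 * (Fintype.card (Fin N) : ℝ))))))) ^ (D' j).card) *
            ∫ U, rhoZeroOfRecord F N p.K g₀ E₀ U ∂(fieldMeasure (F.P p.K) 0 (SU N)) := by
  obtain ⟨τ, hτ, v, hv, h36⟩ := sum_admS_integral_le_rec_allLevels_byValue F N ν M p g A₁
  refine ⟨τ, hτ, v, hv, ?_⟩
  intro g₀ E₀ hg J hJ hJm hdiv hsz hε D
  choose D' hsub hdisj hcard using fun j => exists_canon_skeleton F ν p g j hM₂ (D j)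
  refine ⟨D', fun j => ⟨hsub j, hcard j⟩, ?_⟩
  intro K' E hE hfree
  have hL0 : (0 : ℝ) < (F.P p.K).L := by exact_mod_cast (F.P p.K).L_pos
  have hN0 : (0 : ℝ) < N := by exact_mod_cast Nat.pos_of_ne_zero (NeZero.ne N)
  -- per-level letters for module 59's `hreg_canon_of_crude` at `B_j := √(N·n⋆_j)·L^{2(j+1)}`
  have hη : ∀ j, 0 < (F.P p.K).eta (j + 1) ^ 2 := fun j => by
    have : 0 < (F.P p.K).eta (j + 1) := by
      unfold Params.eta
      exact pow_pos (inv_pos.2 hL0) _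
    positivity
  have hn1 : ∀ j, (1 : ℝ) ≤ (((F.P p.K).d ^ 2 * (9 * sideχ F ν p g j) ^ (F.P p.K).d : ℕ) : ℝ) := fun j => by
    have hs : 1 ≤ sideχ F ν p g j := by
      unfold sideχ cubeSide
      exact Nat.one_le_iff_ne_zero.2 (Nat.mul_ne_zero (Nat.mul_ne_zero (pow_ne_zero _ (F.P p.K).L_pos.ne') (by omega))
        (by have := B14SeparationOfRecord.one_le_RkOfRecord (F.P p.K).L_pos ν.r (g (j + 1)); omega))
    exact_mod_cast Nat.one_le_iff_ne_zero.2 (Nat.mul_ne_zero (pow_ne_zero _ (by have := (F.P p.K).hd; omega)) (pow_ne_zero _ (by omega)))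
  have hB0 : ∀ j, 0 < Real.sqrt ((N : ℝ) * (((F.P p.K).d ^ 2 * (9 * sideχ F ν p g j) ^ (F.P p.K).d : ℕ) : ℝ)) *
      ((F.P p.K).L : ℝ) ^ (2 * (j + 1)) := fun j => by
    have := hn1 j
    have : 0 < Real.sqrt ((N : ℝ) * (((F.P p.K).d ^ 2 * (9 * sideχ F ν p g j) ^ (F.P p.K).d : ℕ) : ℝ)) := Real.sqrt_pos.2 (by positivity)
    positivity
  have hBη : ∀ j, Real.sqrt ((N : ℝ) * (((F.P p.K).d ^ 2 * (9 * sideχ F ν p g j) ^ (F.P p.K).d : ℕ) : ℝ)) ≤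
      Real.sqrt ((N : ℝ) * (((F.P p.K).d ^ 2 * (9 * sideχ F ν p g j) ^ (F.P p.K).d : ℕ) : ℝ)) * ((F.P p.K).L : ℝ) ^ (2 * (j + 1)) *
        (F.P p.K).eta (j + 1) ^ 2 := fun j => by
    unfold Params.eta
    rw [← pow_mul, inv_pow, mul_comm (j + 1) 2, mul_assoc, mul_inv_cancel₀ (by positivity), mul_one]
  have hreg : ∀ j ∈ J, ∀ c ∈ D' j, ∀ V' : GaugeField (F.P p.K) (j + 1) (SU N),
      (∀ p' ∈ (Finset.univ.filter fun q : Plaq (F.P p.K) (j + 1) => embIter (j + 1) q.src ∈ cubeEnl (F.P p.K) (sideχ F ν p g j) c 4),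
        dist1 (GaugeField.plaqHol V' p') < epsOfRecord ν g (j + 1) /
          (Real.sqrt ((N : ℝ) * (((F.P p.K).d ^ 2 * (9 * sideχ F ν p g j) ^ (F.P p.K).d : ℕ) : ℝ)) * ((F.P p.K).L : ℝ) ^ (2 * (j + 1)))) →
      chiFactor F N ν p g j c V' = 1 := fun j hj c _ V' hV' =>
    hreg_canon_of_crude F N ν p g (hJm j hj) hM₁ (hdiv j hj) (hsz j hj) (hB0 j) (hε j hj) (mul_pos (hε j hj) (hη j)) (hBη j) c V' hV'
  exact h36 g₀ E₀ hg J hJ D'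
    (fun j c => Finset.univ.filter fun q : Plaq (F.P p.K) (j + 1) => embIter (j + 1) q.src ∈ cubeEnl (F.P p.K) (sideχ F ν p g j) c 4)
    (fun j => (F.P p.K).d ^ 2 * (9 * ((F.P p.K).L * ν.M₂ * RkOfRecord (F.P p.K).L ν.r (g (j + 1)))) ^ (F.P p.K).d)
    (fun j => epsOfRecord ν g (j + 1) /
      (Real.sqrt ((N : ℝ) * (((F.P p.K).d ^ 2 * (9 * sideχ F ν p g j) ^ (F.P p.K).d : ℕ) : ℝ)) * ((F.P p.K).L : ℝ) ^ (2 * (j + 1))))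
    (fun j hj => (div_pos (hε j hj) (hB0 j)).le) (fun j hj c _ => card_canon_le F ν p g j (hJm j hj) c) (fun j _ => hdisj j) hreg K' E
    (fun j hj h t ht => (hsub j).trans (hE j hj h t ht)) hfree

end Summit.QuantumFields.YangMills.BalabanUVNodes.N20LCSAllLevelsCrude

end
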